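import Literature.MathematicalPhysics.QuantumFieldTheory.Balaban1983to89.B6Prop22AdjTwoLevelBox
import Literature.MathematicalPhysics.QuantumFieldTheory.Balaban1983to89.B6Prop22LapTwoLevelBox
import Literature.MathematicalPhysics.QuantumFieldTheory.Balaban1983to89.B6Prop22HolderTwoLevelBox
import Literature.MathematicalPhysics.QuantumFieldTheory.Balaban1983to89.B6Prop22DualHolderTwoLevelBox

/-!
# `Balaban1983to89.B6Prop22AllTwoLevelBox` — [B6] Proposition 2.2 (2.67), THE FIVE CERTIFIED ENTRIES WITH COMMON
CONSTANTS, AND THE CONVERGENCE CLAUSE «The random walk representation (2.50) is convergent in the norms defined by these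
inequalities» IN QUANTITATIVE FORM, for the genuine two-level operator `Δ_Ω^{L^{−j},N} + m² + Q′*aQ′` on a box of
`L`-blocks (file 11 of the two-level parametrix; nothing existing is touched; no fact is minted)

FRAMING (verbatim cell line):
statement-level skeleton of published theorems with citation tags; proofs where landed; nothing here is a claim about the Yang–Mills mass gap

Source under audit (cell pub-balaban): T. Bałaban, *Propagators and renormalization transformations for lattice gauge
theories. II*, Commun. Math. Phys. **96** (1984) 223–250 [`Balaban1984PropagatorsII`, "B6"], p. 234 [PDF 12] Proposition
2.2 (2.67) and its last sentence (render `b2b-balaban-ref1/pages/1984-cmp96-propagators-rt-II/…-p012-x2.png`), p. 232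
[PDF 10] (2.50) «G′ = G′₀(I − R)^{−1} = Σ_ω h_{□₀}G′(□₀)h_{□₀}K(h_{□₁})G′(□₁)h_{□₁}…».

## WHAT IS PRINTED (p. 234)

«Proposition 2.2. If we have (2.1), (2.2) and M is sufficiently large, then the operator G′ = Δ′_a^{−1}(a = 1) satisfies
the inequalities |(G′λ)(x)|, |(∇G′λ)(x)|, |(G′∇*λ)(x)|, ‖ζ∇G′λ‖_α, ‖ζG′∇*λ‖_α, |(ΔG′λ)(x)| ≤ O(1)[(L^jη)², L^jη, L^jη,
(L^jη)^{1−α}(‖ζ‖_α + |ζ|), (L^jη)^{1−α}(‖ζ‖_α + |ζ|), 1]e^{−½δ₀d(y,y′)}|λ| … (2.67)»  — ONE `O(1)`, ONE `δ₀`, ONE «M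
sufficiently large» for all entries; «The random walk representation (2.50) is convergent in the norms defined by
these inequalities.»

## WHAT THIS FILE CERTIFIES (kernel-checked; `A = 0`)

`prop22_twoLevelBox`: the conjunction, WITH COMMON CONSTANTS `δ, M₀, C` (functions of `d`, `L`, `α`, the windows), of the
five entries certified entry by entry in `B6Prop22TwoLevelBox` (first, `G′λ`), `B6Prop22DerivTwoLevelBox` (second, `∇G′λ`),
`B6Prop22AdjTwoLevelBox` (third, `G′∇*λ`), `B6Prop22HolderTwoLevelBox` (fourth, the Hölder quotient of `∇G′λ`) and
`B6Prop22LapTwoLevelBox` (sixth, `ΔG′λ`), each in its weighted-row / weighted-functional form, for EVERY mesh `k ≥ 1`,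
`M_h ≥ 3` with `L·M_h ≥ M₀`, volume, block union and window point.  HONEST SCOPE: as in those files (`k = 1` geometry of
the parametrix, `A = 0`, Neumann box, one cube size, printed cut-offs; `ζ` dispensed with as in [3] (1.9)); the FIFTH entry
`‖ζG′∇*λ‖_α` is certified separately (`B6Prop22DualHolderTwoLevelBox.prop22_entry5_twoLevelBox`, via the column companion of
[3] (1.9), `B4Thm19ZeroBoxHolderDual`) and joined in §6 (v2): `prop22_six_twoLevelBox` — ALL SIX entries with common
constants.

`prop22_series_twoLevelBox`: THE CONVERGENCE CLAUSE, quantitatively.  With `G′₀ = Σ_q h_qG′(□_q)h_q`, `R` of (2.38)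
(`B6Eq250.rOp`) and the partial sums `S_N = Σ_{m<N}R^m`, `S_N^† = Σ_{m<N}(Rᵀ)^m`: the algebra `G′ − G′₀S_N = G′R^N`
(`sub_mul_partialSum_eq`, from `G′ = G′₀ + G′R`) and `G′ − S_N^†G′₀ = (Rᵀ)^NG′` (`sub_partialSum_mul_eq`, from `G′ = G′₀ +
RᵀG′`), the geometric bounds along powers (`roww_mul_pow_le`, `roww_pow_mul_le`, `wsum_vecMul_pow_le`,
`wsum2_vecMul_pow_le`) and, for `L·M_h ≥ M₀` (forcing `sup roww(R), sup roww(Rᵀ) ≤ ½`), for EVERY `N`: the five functionals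
of (2.67) of the remainders (entries 1, 2, 4, 6 for `G′ − G′₀S_N`; entry 3 for `G′ − S_N^†G′₀`, the ordering in which the
third entry was certified) are `≤ C·2^{−N}` — the partial sums of (2.50) converge to `G′` geometrically in each norm.
HONEST LABEL: for the symmetric `G′` both orderings of (2.50) represent `G′`; the print's path expansion `Σ_ω` is the
entrywise expansion of `G′₀R^n` (`B6Ineq249TwoLevelBox.eq250_twoLevelBox`), not re-expanded here.

Value = one quotable package of the two-level (2.67) at `A = 0` with its convergence clause; NOT summit progress (the
Yang–Mills statements are untouched).
-/

namespace Literature.MathematicalPhysics.QuantumFieldTheory.Balaban1983to89.B6Prop22AllTwoLevelBox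

open Finset Matrix
open Literature.MathematicalPhysics.QuantumFieldTheory.Balaban1983to89.B4Reflection242 (boxDom)
open Literature.MathematicalPhysics.QuantumFieldTheory.Balaban1983to89.B4ContourShift (supNorm)
open Literature.MathematicalPhysics.QuantumFieldTheory.Balaban1983to89.B4Lemma22ReduceZero (Box)
open Literature.MathematicalPhysics.QuantumFieldTheory.Balaban1983to89.B4Thm110ZeroBox (roww roww_nonneg)
open Literature.MathematicalPhysics.QuantumFieldTheory.Balaban1983to89.B4Thm110ZeroBoxDeriv (wsum wsum_nonneg)
open Literature.MathematicalPhysics.QuantumFieldTheory.Balaban1983to89.B4Thm19ZeroBoxHolder (wsum2 wsum2_nonneg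
  wsum2_mono_rate)
open Literature.MathematicalPhysics.QuantumFieldTheory.Balaban1983to89.B6Ineq243TwoLevelBox
open Literature.MathematicalPhysics.QuantumFieldTheory.Balaban1983to89.B6Eq238TwoLevelBox (hDiag gPad)
open Literature.MathematicalPhysics.QuantumFieldTheory.Balaban1983to89.B6Ineq243AdjTwoLevelBox (dstar dstar_mul)
open Literature.MathematicalPhysics.QuantumFieldTheory.Balaban1983to89.B6Prop22TwoLevelBox (prop22_entry1_twoLevelBox
  roww_rOp_le gTwoLevel_eq_gZero_add)
open Literature.MathematicalPhysics.QuantumFieldTheory.Balaban1983to89.B6Prop22DerivTwoLevelBox (prop22_entry2_twoLevelBox)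
open Literature.MathematicalPhysics.QuantumFieldTheory.Balaban1983to89.B6Prop22AdjTwoLevelBox (prop22_entry3_twoLevelBox
  roww_transpose_rOp_le gTwoLevel_eq_gZero_add_transpose)
open Literature.MathematicalPhysics.QuantumFieldTheory.Balaban1983to89.B6Prop22LapTwoLevelBox (lapOp prop22_entry6_twoLevelBox)
open Literature.MathematicalPhysics.QuantumFieldTheory.Balaban1983to89.B6Prop22HolderTwoLevelBox (prop22_entry4_twoLevelBox)
open Literature.MathematicalPhysics.QuantumFieldTheory.Balaban1983to89.B6Prop22DualHolderTwoLevelBox (prop22_entry5_twoLevelBox)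
open Literature.MathematicalPhysics.QuantumFieldTheory.Balaban1983to89.B6Ineq243HolderTwoLevelBox (wsum2_vecMul_le)

noncomputable section

variable {d : ℕ}

/-! ## §1 The five certified entries with common constants -/

/-- **[B6] PROPOSITION 2.2 (2.67) FOR THE GENUINE TWO-LEVEL OPERATOR ON A BOX OF `L`-BLOCKS — THE FIVE CERTIFIED ENTRIES
WITH COMMON CONSTANTS.**  For every dimension, block size, windows and `0 ≤ α < 1` there are `δ, M₀, C > 0` such that for
EVERY mesh `k ≥ 1` (`n = L^k`, `ξ = 1/n`), every point of the windows, every `M_h ≥ 3` with `L·M_h ≥ M₀` («M sufficiently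
large»), every volume `P`, every block union `Λ`, with `G′ = (Δ_Ω^{ξ,N} + m² + Q′*aQ′)^{−1}` on `Ω = Π_μ[0, LM_hP_μ)`:
(1) `sup_x Σ_z|G′(x,z)|e^{δ|x−z|/n} ≤ C`; (2) `Σ_z|ξ^{−1}(G′(x+e_μ,z) − G′(x,z))|e^{δ|x−z|/n} ≤ C`;
(3) `Σ_z|ξ^{−1}(G′(x,z+e_μ) − G′(x,z))|e^{δ|x−z|/n} ≤ C` (`G′∇*`);
(4) `Σ_z (n/|x′−x|_∞)^α|ξ^{−1}(((G′(x′+e_μ,z) − G′(x′,z)) − (G′(x+e_μ,z) − G′(x,z)))|e^{δmin(|x−z|,|x′−z|)/n} ≤ C` (`x ≠ x′`);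
(6) `Σ_z|(ξ^{−2}Δ^N_ΩG′)(x,z)|e^{δ|x−z|/n} ≤ C`.
[cite: Balaban1984PropagatorsII, Proposition 2.2 (2.67) p.234] -/
theorem prop22_twoLevelBox (d ℓ : ℕ) (hℓ : 1 ≤ ℓ) (aminus aplus m2plus a2minus a2plus : ℝ) (ha : 0 < aminus)
    (ha2 : 0 < a2minus) (α : ℝ) (hα0 : 0 ≤ α) (hα1 : α < 1) :
    ∃ δ M₀ C : ℝ, 0 < δ ∧ 0 < M₀ ∧ 0 < C ∧ ∀ (k : ℕ), 1 ≤ k → ∀ (aj m2 a : ℝ), aminus ≤ aj → aj ≤ aplus → 0 ≤ m2 →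
      m2 ≤ m2plus → a2minus ≤ a → a ≤ a2plus → ∀ (Mh : ℕ), 3 ≤ Mh → M₀ ≤ ((ℓ : ℝ) + 1) * Mh →
        ∀ (P : Fin (d + 1) → ℕ), (∀ i, 1 ≤ P i) → ∀ (Λ : Finset ↥(boxDom (fun i => (ℓ + 1) * (Mh * P i)))),
        IsBlockUnion ℓ (fun i => Mh * P i) Λ →
        (∀ x : ↥(Box d ℓ k (fun i => (ℓ + 1) * (Mh * P i))),
          roww δ ((ℓ + 1) ^ k) (gTwoLevel ((ℓ + 1) ^ k) ℓ aj a m2 (fun i => Mh * P i) Λ) x ≤ C)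
        ∧ (∀ (μ : Fin (d + 1)) (x xe : ↥(Box d ℓ k (fun i => (ℓ + 1) * (Mh * P i)))), xe.1 = x.1 + Pi.single μ 1 →
          wsum δ ((ℓ + 1) ^ k) x (fun z => (((ℓ + 1) ^ k : ℕ) : ℝ)
              * (gTwoLevel ((ℓ + 1) ^ k) ℓ aj a m2 (fun i => Mh * P i) Λ xe z
                - gTwoLevel ((ℓ + 1) ^ k) ℓ aj a m2 (fun i => Mh * P i) Λ x z)) ≤ C)
        ∧ (∀ (μ : Fin (d + 1)) (x : ↥(Box d ℓ k (fun i => (ℓ + 1) * (Mh * P i)))),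
          roww δ ((ℓ + 1) ^ k) (dstar ((ℓ + 1) ^ k) μ (gTwoLevel ((ℓ + 1) ^ k) ℓ aj a m2 (fun i => Mh * P i) Λ)) x
            ≤ C)
        ∧ (∀ (μ : Fin (d + 1)) (x xe x' xe' : ↥(Box d ℓ k (fun i => (ℓ + 1) * (Mh * P i)))),
          xe.1 = x.1 + Pi.single μ 1 → xe'.1 = x'.1 + Pi.single μ 1 → x'.1 ≠ x.1 →
          wsum2 δ ((ℓ + 1) ^ k) x x' (fun z => ((((ℓ + 1) ^ k : ℕ) : ℝ) / supNorm (x'.1 - x.1)) ^ α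
              * ((((ℓ + 1) ^ k : ℕ) : ℝ)
                * ((gTwoLevel ((ℓ + 1) ^ k) ℓ aj a m2 (fun i => Mh * P i) Λ xe' z
                    - gTwoLevel ((ℓ + 1) ^ k) ℓ aj a m2 (fun i => Mh * P i) Λ x' z)
                  - (gTwoLevel ((ℓ + 1) ^ k) ℓ aj a m2 (fun i => Mh * P i) Λ xe z
                    - gTwoLevel ((ℓ + 1) ^ k) ℓ aj a m2 (fun i => Mh * P i) Λ x z)))) ≤ C)
        ∧ (∀ x : ↥(Box d ℓ k (fun i => (ℓ + 1) * (Mh * P i))),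
          roww δ ((ℓ + 1) ^ k) (lapOp ((ℓ + 1) ^ k) _ * gTwoLevel ((ℓ + 1) ^ k) ℓ aj a m2 (fun i => Mh * P i) Λ) x
            ≤ C) := by
  obtain ⟨δ₁, M₁, C₁, hδ₁, hM₁, hC₁, h1⟩ := prop22_entry1_twoLevelBox d ℓ hℓ aminus aplus m2plus a2minus a2plus ha ha2
  obtain ⟨δ₂, M₂, C₂, hδ₂, hM₂, hC₂, h2⟩ := prop22_entry2_twoLevelBox d ℓ hℓ aminus aplus m2plus a2minus a2plus ha ha2
  obtain ⟨δ₃, M₃, C₃, hδ₃, hM₃, hC₃, h3⟩ := prop22_entry3_twoLevelBox d ℓ hℓ aminus aplus m2plus a2minus a2plus ha ha2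
  obtain ⟨δ₄, M₄, C₄, hδ₄, hM₄, hC₄, h4⟩ :=
    prop22_entry4_twoLevelBox d ℓ hℓ aminus aplus m2plus a2minus a2plus ha ha2 α hα0 hα1
  obtain ⟨δ₆, M₆, C₆, hδ₆, hM₆, hC₆, h6⟩ := prop22_entry6_twoLevelBox d ℓ hℓ aminus aplus m2plus a2minus a2plus ha ha2
  refine ⟨min (min δ₁ δ₂) (min δ₃ (min δ₄ δ₆)), M₁ + M₂ + M₃ + M₄ + M₆, C₁ + C₂ + C₃ + C₄ + C₆,
    lt_min (lt_min hδ₁ hδ₂) (lt_min hδ₃ (lt_min hδ₄ hδ₆)), by positivity, by positivity, ?_⟩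
  intro k hk aj m2 a e1 e2 e3 e4 e5 e6 Mh hMh hM P hP Λ hΛ
  have hd1 : min (min δ₁ δ₂) (min δ₃ (min δ₄ δ₆)) ≤ δ₁ := (min_le_left _ _).trans (min_le_left _ _)
  have hd2 : min (min δ₁ δ₂) (min δ₃ (min δ₄ δ₆)) ≤ δ₂ := (min_le_left _ _).trans (min_le_right _ _)
  have hd3 : min (min δ₁ δ₂) (min δ₃ (min δ₄ δ₆)) ≤ δ₃ := (min_le_right _ _).trans (min_le_left _ _)
  have hd4 : min (min δ₁ δ₂) (min δ₃ (min δ₄ δ₆)) ≤ δ₄ :=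
    (min_le_right _ _).trans ((min_le_right _ _).trans (min_le_left _ _))
  have hd6 : min (min δ₁ δ₂) (min δ₃ (min δ₄ δ₆)) ≤ δ₆ :=
    (min_le_right _ _).trans ((min_le_right _ _).trans (min_le_right _ _))
  have hm1 : M₁ ≤ ((ℓ : ℝ) + 1) * Mh := by linarith
  have hm2 : M₂ ≤ ((ℓ : ℝ) + 1) * Mh := by linarith
  have hm3 : M₃ ≤ ((ℓ : ℝ) + 1) * Mh := by linarith
  have hm4 : M₄ ≤ ((ℓ : ℝ) + 1) * Mh := by linarith
  have hm6 : M₆ ≤ ((ℓ : ℝ) + 1) * Mh := by linarith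
  refine ⟨fun x => ?_, fun μ x xe hxe => ?_, fun μ x => ?_, fun μ x xe x' xe' hxe hxe' hne => ?_, fun x => ?_⟩
  · have := (roww_mono hd1 _ _ _).trans (h1 k hk aj m2 a e1 e2 e3 e4 e5 e6 Mh hMh hm1 P hP Λ hΛ x)
    linarith
  · have := (wsum_mono hd2 _ _ _).trans (h2 k hk aj m2 a e1 e2 e3 e4 e5 e6 Mh hMh hm2 P hP Λ hΛ μ x xe hxe)
    linarith
  · have := (roww_mono hd3 _ _ _).trans (h3 k hk aj m2 a e1 e2 e3 e4 e5 e6 Mh hMh hm3 P hP Λ hΛ μ x)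
    linarith
  · have := (wsum2_mono_rate hd4 _ _ _ _).trans
      (h4 k hk aj m2 a e1 e2 e3 e4 e5 e6 Mh hMh hm4 P hP Λ hΛ μ x xe x' xe' hxe hxe' hne)
    linarith
  · have := (roww_mono hd6 _ _ _).trans (h6 k hk aj m2 a e1 e2 e3 e4 e5 e6 Mh hMh hm6 P hP Λ hΛ x)
    linarith

/-! ## §2 Algebra of the partial sums of (2.50) -/

section Algebra

variable {X : Type*} [Fintype X]

/-- differencing two rows of a product: `t((AB)(p,z) − (AB)(q,z)) = Σ_y t(A(p,y) − A(q,y))B(y,z)`. [folklore] -/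
private theorem mul_row_sub (A B : Matrix X X ℝ) (t : ℝ) (p q z : X) :
    t * ((A * B) p z - (A * B) q z) = ∑ y, (t * (A p y - A q y)) * B y z := by
  simp only [Matrix.mul_apply]
  rw [← Finset.sum_sub_distrib, Finset.mul_sum]
  exact Finset.sum_congr rfl fun y _ => by ring

/-- doubly differencing the rows of a product. [folklore] -/
private theorem mul_row_dd (A B : Matrix X X ℝ) (W t : ℝ) (p' q' p q z : X) :
    W * (t * (((A * B) p' z - (A * B) q' z) - ((A * B) p z - (A * B) q z)))
      = ∑ y, (W * (t * ((A p' y - A q' y) - (A p y - A q y)))) * B y z := by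
  simp only [Matrix.mul_apply]
  rw [← Finset.sum_sub_distrib, ← Finset.sum_sub_distrib, ← Finset.sum_sub_distrib, Finset.mul_sum, Finset.mul_sum]
  exact Finset.sum_congr rfl fun y _ => by ring

variable [DecidableEq X]

/-- `G′ − G′₀S_N = G′R^N` for `S_N = Σ_{m<N}R^m`, from `G′ = G′₀ + G′R`. [cite: Balaban1984PropagatorsII, (2.50) p.232] -/
theorem sub_mul_partialSum_eq (G G₀ R : Matrix X X ℝ) (h : G = G₀ + G * R) (N : ℕ) :
    G - G₀ * ∑ m ∈ Finset.range N, R ^ m = G * R ^ N := by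
  have hGR : G - G₀ = G * R := by
    conv_lhs => rw [h]
    rw [add_sub_cancel_left]
  induction N with
  | zero => simp
  | succ N ih =>
      rw [Finset.sum_range_succ, Matrix.mul_add, ← sub_sub, ih, ← Matrix.sub_mul, hGR, Matrix.mul_assoc,
        ← pow_succ']

/-- `G′ − S_N^†G′₀ = (Rᵀ)^NG′` for `S_N^† = Σ_{m<N}(Rᵀ)^m`, from `G′ = G′₀ + RᵀG′`. [cite: Balaban1984PropagatorsII, (2.50) p.232] -/
theorem sub_partialSum_mul_eq (G G₀ Rt : Matrix X X ℝ) (h : G = G₀ + Rt * G) (N : ℕ) :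
    G - (∑ m ∈ Finset.range N, Rt ^ m) * G₀ = Rt ^ N * G := by
  have hGR : G - G₀ = Rt * G := by
    conv_lhs => rw [h]
    rw [add_sub_cancel_left]
  induction N with
  | zero => simp
  | succ N ih =>
      rw [Finset.sum_range_succ, Matrix.add_mul, ← sub_sub, ih, ← Matrix.mul_sub, hGR, ← Matrix.mul_assoc,
        ← pow_succ]

end Algebra

/-! ## §3 Geometric decay of the functionals along powers of `R` -/

section Powers

variable {N : Fin (d + 1) → ℕ}

/-- `wsum` depends only on the function. [folklore] -/
private theorem wsum_congr' (δ : ℝ) (n : ℕ) (x : ↥(boxDom N)) {g g' : ↥(boxDom N) → ℝ} (h : ∀ z, g z = g' z) :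
    wsum δ n x g = wsum δ n x g' := by
  unfold wsum
  exact Finset.sum_congr rfl fun z _ => by rw [h z]

/-- `wsum2` depends only on the function. [folklore] -/
private theorem wsum2_congr' (δ : ℝ) (n : ℕ) (x x' : ↥(boxDom N)) {g g' : ↥(boxDom N) → ℝ}
    (h : ∀ z, g z = g' z) : wsum2 δ n x x' g = wsum2 δ n x x' g' := by
  unfold wsum2
  exact Finset.sum_congr rfl fun z _ => by rw [h z]

/-- **ROWS ALONG POWERS**: `roww(AR^m)(x) ≤ roww(A)(x)·θ^m` if `sup roww(R) ≤ θ`.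
[cite: Balaban1984PropagatorsII, (2.50) p.232, (2.65)–(2.66) p.234] -/
theorem roww_mul_pow_le {δ : ℝ} (hδ : 0 ≤ δ) (n : ℕ) (A R : Matrix ↥(boxDom N) ↥(boxDom N) ℝ) {θ : ℝ}
    (hθ : 0 ≤ θ) (hR : ∀ y, roww δ n R y ≤ θ) (x : ↥(boxDom N)) :
    ∀ m : ℕ, roww δ n (A * R ^ m) x ≤ roww δ n A x * θ ^ m := by
  intro m
  induction m with
  | zero => simp
  | succ m ih =>
      rw [pow_succ, ← Matrix.mul_assoc, pow_succ, ← mul_assoc]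
      exact (roww_mul_le hδ n _ R hR x).trans (mul_le_mul_of_nonneg_right ih hθ)

/-- **ROWS ALONG POWERS, LEFT**: `roww(R^mD)(x) ≤ θ^m·sup roww(D)` if `sup roww(R) ≤ θ`.
[cite: Balaban1984PropagatorsII, (2.50) p.232, (2.65)–(2.66) p.234] -/
theorem roww_pow_mul_le {δ : ℝ} (hδ : 0 ≤ δ) (n : ℕ) (R D : Matrix ↥(boxDom N) ↥(boxDom N) ℝ) {θ ρ : ℝ}
    (hR : ∀ y, roww δ n R y ≤ θ) (hD : ∀ y, roww δ n D y ≤ ρ) :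
    ∀ (m : ℕ) (x : ↥(boxDom N)), roww δ n (R ^ m * D) x ≤ θ ^ m * ρ := by
  intro m
  induction m with
  | zero => intro x; simpa using hD x
  | succ m ih =>
      intro x
      have hρ : 0 ≤ θ ^ m * ρ := le_trans (roww_nonneg _ _ _ _) (ih x)
      rw [pow_succ', Matrix.mul_assoc, pow_succ']
      calc roww δ n (R * (R ^ m * D)) x ≤ roww δ n R x * (θ ^ m * ρ) := roww_mul_le hδ n R _ ih x
        _ ≤ θ * (θ ^ m * ρ) := mul_le_mul_of_nonneg_right (hR x) hρ
        _ = θ * θ ^ m * ρ := by ring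

/-- **VECTORS ALONG POWERS**: `wsum_x(v·R^m) ≤ wsum_x(v)·θ^m` if `sup roww(R) ≤ θ`.
[cite: Balaban1984PropagatorsII, (2.50) p.232, (2.65)–(2.66) p.234] -/
theorem wsum_vecMul_pow_le {δ : ℝ} (hδ : 0 ≤ δ) (n : ℕ) (x : ↥(boxDom N)) (v : ↥(boxDom N) → ℝ)
    (R : Matrix ↥(boxDom N) ↥(boxDom N) ℝ) {θ : ℝ} (hθ : 0 ≤ θ) (hR : ∀ y, roww δ n R y ≤ θ) :
    ∀ m : ℕ, wsum δ n x (fun z => ∑ y, v y * (R ^ m) y z) ≤ wsum δ n x v * θ ^ m := by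
  intro m
  induction m with
  | zero =>
      have : (fun z => ∑ y, v y * ((R ^ 0) y z)) = v := by
        funext z
        simp only [pow_zero, Matrix.one_apply, mul_ite, mul_one, mul_zero, Finset.sum_ite_eq',
          Finset.mem_univ, if_true]
      rw [this, pow_zero, mul_one]
  | succ m ih =>
      have e : ∀ z, ∑ y, v y * (R ^ (m + 1)) y z = ∑ w, (∑ y, v y * (R ^ m) y w) * R w z := by
        intro z
        simp only [pow_succ, Matrix.mul_apply, Finset.mul_sum, Finset.sum_mul]
        rw [Finset.sum_comm]
        exact Finset.sum_congr rfl fun w _ => Finset.sum_congr rfl fun y _ => by ring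
      rw [wsum_congr' δ n x e, pow_succ, ← mul_assoc]
      exact (wsum_vecMul_le hδ n x _ R hR).trans (mul_le_mul_of_nonneg_right ih hθ)

/-- **TWO-CENTRE VECTORS ALONG POWERS**: `wsum2_{x,x′}(v·R^m) ≤ wsum2_{x,x′}(v)·θ^m` if `sup roww(R) ≤ θ`.
[cite: Balaban1984PropagatorsII, (2.50) p.232, (2.65)–(2.66) p.234] -/
theorem wsum2_vecMul_pow_le {δ : ℝ} (hδ : 0 ≤ δ) (n : ℕ) (x x' : ↥(boxDom N)) (v : ↥(boxDom N) → ℝ)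
    (R : Matrix ↥(boxDom N) ↥(boxDom N) ℝ) {θ : ℝ} (hθ : 0 ≤ θ) (hR : ∀ y, roww δ n R y ≤ θ) :
    ∀ m : ℕ, wsum2 δ n x x' (fun z => ∑ y, v y * (R ^ m) y z) ≤ wsum2 δ n x x' v * θ ^ m := by
  intro m
  induction m with
  | zero =>
      have : (fun z => ∑ y, v y * ((R ^ 0) y z)) = v := by
        funext z
        simp only [pow_zero, Matrix.one_apply, mul_ite, mul_one, mul_zero, Finset.sum_ite_eq',
          Finset.mem_univ, if_true]
      rw [this, pow_zero, mul_one]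
  | succ m ih =>
      have e : ∀ z, ∑ y, v y * (R ^ (m + 1)) y z = ∑ w, (∑ y, v y * (R ^ m) y w) * R w z := by
        intro z
        simp only [pow_succ, Matrix.mul_apply, Finset.mul_sum, Finset.sum_mul]
        rw [Finset.sum_comm]
        exact Finset.sum_congr rfl fun w _ => Finset.sum_congr rfl fun y _ => by ring
      rw [wsum2_congr' δ n x x' e, pow_succ, ← mul_assoc]
      exact (wsum2_vecMul_le hδ n x x' _ R hR).trans (mul_le_mul_of_nonneg_right ih hθ)

end Powers

/-! ## §4 «The random walk representation (2.50) is convergent in the norms defined by these inequalities» -/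

section Series

/-- **[B6] PROPOSITION 2.2, THE CONVERGENCE CLAUSE, FOR THE GENUINE TWO-LEVEL OPERATOR ON A BOX — QUANTITATIVE FORM.**
There are `δ, M₀, C > 0` (functions of `d`, `L`, `α`, the windows) such that for EVERY mesh `k ≥ 1` (`n = L^k`), window
point, `M_h ≥ 3` with `L·M_h ≥ M₀`, volume `P`, block union `Λ` and EVERY `N`, with `G′ = gTwoLevel`, `G′₀`, `R` of (2.38)
and `S_N = Σ_{m<N}R^m`, `S_N^† = Σ_{m<N}(Rᵀ)^m`:
(1) `sup_x Σ_z|(G′ − G′₀S_N)(x,z)|e^{δ|x−z|/n} ≤ C·2^{−N}`; (2) the differenced rows of `G′ − G′₀S_N` have `wsum ≤ C·2^{−N}`;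
(3) `roww(∂*_μ-columns of (G′ − S_N^†G′₀)) ≤ C·2^{−N}`; (4) the Hölder-weighted doubly differenced rows of `G′ − G′₀S_N`
have `wsum2 ≤ C·2^{−N}`; (6) `roww(n²Δ^N(G′ − G′₀S_N)) ≤ C·2^{−N}` — i.e. the partial sums of (2.50) converge to `G′`
geometrically in each of the five certified functionals of (2.67).
[cite: Balaban1984PropagatorsII, Proposition 2.2 p.234 («The random walk representation (2.50) is convergent in the norms defined by these inequalities»), (2.50) p.232, (2.65)–(2.66) p.234] -/
theorem prop22_series_twoLevelBox (d ℓ : ℕ) (hℓ : 1 ≤ ℓ) (aminus aplus m2plus a2minus a2plus : ℝ) (ha : 0 < aminus)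
    (ha2 : 0 < a2minus) (α : ℝ) (hα0 : 0 ≤ α) (hα1 : α < 1) :
    ∃ δ M₀ C : ℝ, 0 < δ ∧ 0 < M₀ ∧ 0 < C ∧ ∀ (k : ℕ), 1 ≤ k → ∀ (aj m2 a : ℝ), aminus ≤ aj → aj ≤ aplus → 0 ≤ m2 →
      m2 ≤ m2plus → a2minus ≤ a → a ≤ a2plus → ∀ (Mh : ℕ), 3 ≤ Mh → M₀ ≤ ((ℓ : ℝ) + 1) * Mh →
        ∀ (P : Fin (d + 1) → ℕ) (hP : ∀ i, 1 ≤ P i) (Λ : Finset ↥(boxDom (fun i => (ℓ + 1) * (Mh * P i)))),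
        IsBlockUnion ℓ (fun i => Mh * P i) Λ → ∀ (Nn : ℕ),
        (∀ x : ↥(Box d ℓ k (fun i => (ℓ + 1) * (Mh * P i))),
          roww δ ((ℓ + 1) ^ k) (gTwoLevel ((ℓ + 1) ^ k) ℓ aj a m2 (fun i => Mh * P i) Λ
            - B6Eq250.gZero (hDiag ℓ k Mh P) (gPad ℓ k Mh P aj a m2 Λ hP)
              * ∑ m ∈ Finset.range Nn, (B6Eq250.rOp (twoLevelOp ((ℓ + 1) ^ k) ℓ aj a m2 (fun i => Mh * P i) Λ)
                (hDiag ℓ k Mh P) (gPad ℓ k Mh P aj a m2 Λ hP)) ^ m) x ≤ C * (1 / 2) ^ Nn)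
        ∧ (∀ (μ : Fin (d + 1)) (x xe : ↥(Box d ℓ k (fun i => (ℓ + 1) * (Mh * P i)))), xe.1 = x.1 + Pi.single μ 1 →
          wsum δ ((ℓ + 1) ^ k) x (fun z => (((ℓ + 1) ^ k : ℕ) : ℝ)
            * ((gTwoLevel ((ℓ + 1) ^ k) ℓ aj a m2 (fun i => Mh * P i) Λ
                - B6Eq250.gZero (hDiag ℓ k Mh P) (gPad ℓ k Mh P aj a m2 Λ hP)
                  * ∑ m ∈ Finset.range Nn, (B6Eq250.rOp (twoLevelOp ((ℓ + 1) ^ k) ℓ aj a m2 (fun i => Mh * P i) Λ)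
                    (hDiag ℓ k Mh P) (gPad ℓ k Mh P aj a m2 Λ hP)) ^ m) xe z
              - (gTwoLevel ((ℓ + 1) ^ k) ℓ aj a m2 (fun i => Mh * P i) Λ
                - B6Eq250.gZero (hDiag ℓ k Mh P) (gPad ℓ k Mh P aj a m2 Λ hP)
                  * ∑ m ∈ Finset.range Nn, (B6Eq250.rOp (twoLevelOp ((ℓ + 1) ^ k) ℓ aj a m2 (fun i => Mh * P i) Λ)
                    (hDiag ℓ k Mh P) (gPad ℓ k Mh P aj a m2 Λ hP)) ^ m) x z)) ≤ C * (1 / 2) ^ Nn)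
        ∧ (∀ (μ : Fin (d + 1)) (x : ↥(Box d ℓ k (fun i => (ℓ + 1) * (Mh * P i)))),
          roww δ ((ℓ + 1) ^ k) (dstar ((ℓ + 1) ^ k) μ
            (gTwoLevel ((ℓ + 1) ^ k) ℓ aj a m2 (fun i => Mh * P i) Λ
              - (∑ m ∈ Finset.range Nn, ((B6Eq250.rOp (twoLevelOp ((ℓ + 1) ^ k) ℓ aj a m2 (fun i => Mh * P i) Λ)
                  (hDiag ℓ k Mh P) (gPad ℓ k Mh P aj a m2 Λ hP))ᵀ) ^ m)
                * B6Eq250.gZero (hDiag ℓ k Mh P) (gPad ℓ k Mh P aj a m2 Λ hP))) x ≤ C * (1 / 2) ^ Nn)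
        ∧ (∀ (μ : Fin (d + 1)) (x xe x' xe' : ↥(Box d ℓ k (fun i => (ℓ + 1) * (Mh * P i)))),
          xe.1 = x.1 + Pi.single μ 1 → xe'.1 = x'.1 + Pi.single μ 1 → x'.1 ≠ x.1 →
          wsum2 δ ((ℓ + 1) ^ k) x x' (fun z => ((((ℓ + 1) ^ k : ℕ) : ℝ) / supNorm (x'.1 - x.1)) ^ α
            * ((((ℓ + 1) ^ k : ℕ) : ℝ)
              * (((gTwoLevel ((ℓ + 1) ^ k) ℓ aj a m2 (fun i => Mh * P i) Λ
                    - B6Eq250.gZero (hDiag ℓ k Mh P) (gPad ℓ k Mh P aj a m2 Λ hP)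
                      * ∑ m ∈ Finset.range Nn, (B6Eq250.rOp (twoLevelOp ((ℓ + 1) ^ k) ℓ aj a m2 (fun i => Mh * P i) Λ)
                        (hDiag ℓ k Mh P) (gPad ℓ k Mh P aj a m2 Λ hP)) ^ m) xe' z
                  - (gTwoLevel ((ℓ + 1) ^ k) ℓ aj a m2 (fun i => Mh * P i) Λ
                    - B6Eq250.gZero (hDiag ℓ k Mh P) (gPad ℓ k Mh P aj a m2 Λ hP)
                      * ∑ m ∈ Finset.range Nn, (B6Eq250.rOp (twoLevelOp ((ℓ + 1) ^ k) ℓ aj a m2 (fun i => Mh * P i) Λ)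
                        (hDiag ℓ k Mh P) (gPad ℓ k Mh P aj a m2 Λ hP)) ^ m) x' z)
                - ((gTwoLevel ((ℓ + 1) ^ k) ℓ aj a m2 (fun i => Mh * P i) Λ
                    - B6Eq250.gZero (hDiag ℓ k Mh P) (gPad ℓ k Mh P aj a m2 Λ hP)
                      * ∑ m ∈ Finset.range Nn, (B6Eq250.rOp (twoLevelOp ((ℓ + 1) ^ k) ℓ aj a m2 (fun i => Mh * P i) Λ)
                        (hDiag ℓ k Mh P) (gPad ℓ k Mh P aj a m2 Λ hP)) ^ m) xe z
                  - (gTwoLevel ((ℓ + 1) ^ k) ℓ aj a m2 (fun i => Mh * P i) Λ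
                    - B6Eq250.gZero (hDiag ℓ k Mh P) (gPad ℓ k Mh P aj a m2 Λ hP)
                      * ∑ m ∈ Finset.range Nn, (B6Eq250.rOp (twoLevelOp ((ℓ + 1) ^ k) ℓ aj a m2 (fun i => Mh * P i) Λ)
                        (hDiag ℓ k Mh P) (gPad ℓ k Mh P aj a m2 Λ hP)) ^ m) x z))))
            ≤ C * (1 / 2) ^ Nn)
        ∧ (∀ x : ↥(Box d ℓ k (fun i => (ℓ + 1) * (Mh * P i))),
          roww δ ((ℓ + 1) ^ k) (lapOp ((ℓ + 1) ^ k) _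
            * (gTwoLevel ((ℓ + 1) ^ k) ℓ aj a m2 (fun i => Mh * P i) Λ
              - B6Eq250.gZero (hDiag ℓ k Mh P) (gPad ℓ k Mh P aj a m2 Λ hP)
                * ∑ m ∈ Finset.range Nn, (B6Eq250.rOp (twoLevelOp ((ℓ + 1) ^ k) ℓ aj a m2 (fun i => Mh * P i) Λ)
                  (hDiag ℓ k Mh P) (gPad ℓ k Mh P aj a m2 Λ hP)) ^ m)) x ≤ C * (1 / 2) ^ Nn) := by
  obtain ⟨δP, MP, CP, hδP, hMP, hCP, hAll⟩ :=
    prop22_twoLevelBox d ℓ hℓ aminus aplus m2plus a2minus a2plus ha ha2 α hα0 hα1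
  obtain ⟨δ₁, CR₁, hδ₁, hCR₁, hR₁⟩ := roww_rOp_le d ℓ hℓ aminus aplus m2plus a2minus a2plus ha ha2
  obtain ⟨δ₃, CR₃, hδ₃, hCR₃, hR₃⟩ := roww_transpose_rOp_le d ℓ hℓ aminus aplus m2plus a2minus a2plus ha ha2
  refine ⟨min δP (min δ₁ δ₃), MP + 2 * CR₁ + 2 * CR₃, CP, lt_min hδP (lt_min hδ₁ hδ₃), by positivity, hCP, ?_⟩
  intro k hk aj m2 a e1 e2 e3 e4 e5 e6 Mh hMh hM P hP Λ hΛ Nn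
  have hMh1 : 1 ≤ Mh := le_trans (by norm_num) hMh
  have hδ0 : 0 ≤ min δP (min δ₁ δ₃) := (lt_min hδP (lt_min hδ₁ hδ₃)).le
  have hdP : min δP (min δ₁ δ₃) ≤ δP := min_le_left _ _
  have hd1 : min δP (min δ₁ δ₃) ≤ δ₁ := (min_le_right _ _).trans (min_le_left _ _)
  have hd3 : min δP (min δ₁ δ₃) ≤ δ₃ := (min_le_right _ _).trans (min_le_right _ _)
  have hMpos : (0 : ℝ) < ((ℓ : ℝ) + 1) * Mh := by
    have : (3 : ℝ) ≤ Mh := by exact_mod_cast hMh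
    have : (0 : ℝ) ≤ ℓ := Nat.cast_nonneg ℓ
    positivity
  have hMP' : MP ≤ ((ℓ : ℝ) + 1) * Mh := by linarith
  have half0 : (0 : ℝ) ≤ 1 / 2 := by norm_num
  obtain ⟨h1, h2, h3, h4, h6⟩ := hAll k hk aj m2 a e1 e2 e3 e4 e5 e6 Mh hMh hMP' P hP Λ hΛ
  -- names
  set G := gTwoLevel ((ℓ + 1) ^ k) ℓ aj a m2 (fun i => Mh * P i) Λ with hG
  set G₀ := B6Eq250.gZero (hDiag ℓ k Mh P) (gPad ℓ k Mh P aj a m2 Λ hP) with hG₀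
  set Rm := B6Eq250.rOp (twoLevelOp ((ℓ + 1) ^ k) ℓ aj a m2 (fun i => Mh * P i) Λ) (hDiag ℓ k Mh P)
    (gPad ℓ k Mh P aj a m2 Λ hP) with hRm
  -- `sup roww(R) ≤ ½`, `sup roww(Rᵀ) ≤ ½` at the common rate
  have hRrow : ∀ y, roww (min δP (min δ₁ δ₃)) ((ℓ + 1) ^ k) Rm y ≤ 1 / 2 := by
    intro y
    refine (roww_mono hd1 _ _ _).trans ((hR₁ k hk aj m2 a e1 e2 e3 e4 e5 e6 Mh hMh P hP Λ hΛ y).trans ?_)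
    calc CR₁ / (((ℓ : ℝ) + 1) * Mh) ≤ CR₁ / (2 * CR₁) :=
          div_le_div_of_nonneg_left hCR₁.le (by positivity) (by linarith)
      _ = 1 / 2 := by field_simp
  have hRtrow : ∀ y, roww (min δP (min δ₁ δ₃)) ((ℓ + 1) ^ k) Rmᵀ y ≤ 1 / 2 := by
    intro y
    refine (roww_mono hd3 _ _ _).trans ((hR₃ k hk aj m2 a e1 e2 e3 e4 e5 e6 Mh hMh P hP Λ hΛ y).trans ?_)
    calc CR₃ / (((ℓ : ℝ) + 1) * Mh) ≤ CR₃ / (2 * CR₃) :=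
          div_le_div_of_nonneg_left hCR₃.le (by positivity) (by linarith)
      _ = 1 / 2 := by field_simp
  -- the two fixed points and the partial-sum identities
  have hfix : G = G₀ + G * Rm :=
    gTwoLevel_eq_gZero_add hℓ hk hMh1 hP (lt_of_lt_of_le ha e1) (lt_of_lt_of_le ha2 e5) e3 hΛ
  have hfixT : G = G₀ + Rmᵀ * G :=
    gTwoLevel_eq_gZero_add_transpose hℓ hk hMh1 hP (lt_of_lt_of_le ha e1) (lt_of_lt_of_le ha2 e5) e3 hΛ
  have hS : G - G₀ * ∑ m ∈ Finset.range Nn, Rm ^ m = G * Rm ^ Nn := sub_mul_partialSum_eq G G₀ Rm hfix Nn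
  have hST : G - (∑ m ∈ Finset.range Nn, (Rmᵀ) ^ m) * G₀ = (Rmᵀ) ^ Nn * G :=
    sub_partialSum_mul_eq G G₀ Rmᵀ hfixT Nn
  rw [hS, hST]
  refine ⟨fun x => ?_, fun μ x xe hxe => ?_, fun μ x => ?_, fun μ x xe x' xe' hxe hxe' hne => ?_, fun x => ?_⟩
  · -- (1)
    calc roww (min δP (min δ₁ δ₃)) ((ℓ + 1) ^ k) (G * Rm ^ Nn) x
        ≤ roww (min δP (min δ₁ δ₃)) ((ℓ + 1) ^ k) G x * (1 / 2) ^ Nn :=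
          roww_mul_pow_le hδ0 _ G Rm half0 hRrow x Nn
      _ ≤ CP * (1 / 2) ^ Nn :=
          mul_le_mul_of_nonneg_right ((roww_mono hdP _ _ _).trans (h1 x)) (pow_nonneg half0 _)
  · -- (2)
    rw [wsum_congr' _ _ x (fun z => mul_row_sub G (Rm ^ Nn) _ xe x z)]
    calc wsum (min δP (min δ₁ δ₃)) ((ℓ + 1) ^ k) x
          (fun z => ∑ y, ((((ℓ + 1) ^ k : ℕ) : ℝ) * (G xe y - G x y)) * (Rm ^ Nn) y z)
        ≤ wsum (min δP (min δ₁ δ₃)) ((ℓ + 1) ^ k) x (fun y => (((ℓ + 1) ^ k : ℕ) : ℝ) * (G xe y - G x y))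
            * (1 / 2) ^ Nn := wsum_vecMul_pow_le hδ0 _ x _ Rm half0 hRrow Nn
      _ ≤ CP * (1 / 2) ^ Nn :=
          mul_le_mul_of_nonneg_right ((wsum_mono hdP _ _ _).trans (h2 μ x xe hxe)) (pow_nonneg half0 _)
  · -- (3)
    rw [dstar_mul]
    have hD : ∀ y, roww (min δP (min δ₁ δ₃)) ((ℓ + 1) ^ k) (dstar ((ℓ + 1) ^ k) μ G) y ≤ CP := fun y =>
      (roww_mono hdP _ _ _).trans (h3 μ y)
    calc roww (min δP (min δ₁ δ₃)) ((ℓ + 1) ^ k) ((Rmᵀ) ^ Nn * dstar ((ℓ + 1) ^ k) μ G) x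
        ≤ (1 / 2) ^ Nn * CP := roww_pow_mul_le hδ0 _ Rmᵀ _ hRtrow hD Nn x
      _ = CP * (1 / 2) ^ Nn := mul_comm _ _
  · -- (4)
    rw [wsum2_congr' _ _ x x' (fun z => mul_row_dd G (Rm ^ Nn) _ _ xe' x' xe x z)]
    calc wsum2 (min δP (min δ₁ δ₃)) ((ℓ + 1) ^ k) x x'
          (fun z => ∑ y, (((((ℓ + 1) ^ k : ℕ) : ℝ) / supNorm (x'.1 - x.1)) ^ α
            * ((((ℓ + 1) ^ k : ℕ) : ℝ) * ((G xe' y - G x' y) - (G xe y - G x y)))) * (Rm ^ Nn) y z)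
        ≤ wsum2 (min δP (min δ₁ δ₃)) ((ℓ + 1) ^ k) x x'
            (fun y => ((((ℓ + 1) ^ k : ℕ) : ℝ) / supNorm (x'.1 - x.1)) ^ α
              * ((((ℓ + 1) ^ k : ℕ) : ℝ) * ((G xe' y - G x' y) - (G xe y - G x y)))) * (1 / 2) ^ Nn :=
          wsum2_vecMul_pow_le hδ0 _ x x' _ Rm half0 hRrow Nn
      _ ≤ CP * (1 / 2) ^ Nn :=
          mul_le_mul_of_nonneg_right ((wsum2_mono_rate hdP _ _ _ _).trans (h4 μ x xe x' xe' hxe hxe' hne))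
            (pow_nonneg half0 _)
  · -- (6)
    rw [← Matrix.mul_assoc]
    exact (roww_mul_pow_le hδ0 _ _ Rm half0 hRrow x Nn).trans
      (mul_le_mul_of_nonneg_right ((roww_mono hdP _ _ _).trans (h6 x)) (pow_nonneg half0 _))

end Series

/-! ## §6 All six entries of (2.67) with common constants (v2, append-only) -/

/-- **[B6] PROPOSITION 2.2 (2.67) FOR THE GENUINE TWO-LEVEL OPERATOR `Δ_Ω^{L^{−j},N} + m² + Q′*aQ′` ON A BOX OF
`L`-BLOCKS — ALL SIX ENTRIES WITH COMMON CONSTANTS** (kernel forms, `A = 0`): the five of `prop22_twoLevelBox` and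
(5) `Σ_z (n/|x′−x|_∞)^α|(G′∂^{ξ*}_μ)(x′,z) − (G′∂^{ξ*}_μ)(x,z)|e^{δmin(|x−z|,|x′−z|)/n} ≤ C` (`x ≠ x′`;
`B6Prop22DualHolderTwoLevelBox.prop22_entry5_twoLevelBox`).
[cite: Balaban1984PropagatorsII, Proposition 2.2 (2.67) p.234 (all entries)] -/
theorem prop22_six_twoLevelBox (d ℓ : ℕ) (hℓ : 1 ≤ ℓ) (aminus aplus m2plus a2minus a2plus : ℝ) (ha : 0 < aminus)
    (ha2 : 0 < a2minus) (α : ℝ) (hα0 : 0 ≤ α) (hα1 : α < 1) :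
    ∃ δ M₀ C : ℝ, 0 < δ ∧ 0 < M₀ ∧ 0 < C ∧ ∀ (k : ℕ), 1 ≤ k → ∀ (aj m2 a : ℝ), aminus ≤ aj → aj ≤ aplus → 0 ≤ m2 →
      m2 ≤ m2plus → a2minus ≤ a → a ≤ a2plus → ∀ (Mh : ℕ), 3 ≤ Mh → M₀ ≤ ((ℓ : ℝ) + 1) * Mh →
        ∀ (P : Fin (d + 1) → ℕ), (∀ i, 1 ≤ P i) → ∀ (Λ : Finset ↥(boxDom (fun i => (ℓ + 1) * (Mh * P i)))),
        IsBlockUnion ℓ (fun i => Mh * P i) Λ →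
        (∀ x : ↥(Box d ℓ k (fun i => (ℓ + 1) * (Mh * P i))),
          roww δ ((ℓ + 1) ^ k) (gTwoLevel ((ℓ + 1) ^ k) ℓ aj a m2 (fun i => Mh * P i) Λ) x ≤ C)
        ∧ (∀ (μ : Fin (d + 1)) (x xe : ↥(Box d ℓ k (fun i => (ℓ + 1) * (Mh * P i)))), xe.1 = x.1 + Pi.single μ 1 →
          wsum δ ((ℓ + 1) ^ k) x (fun z => (((ℓ + 1) ^ k : ℕ) : ℝ)
              * (gTwoLevel ((ℓ + 1) ^ k) ℓ aj a m2 (fun i => Mh * P i) Λ xe z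
                - gTwoLevel ((ℓ + 1) ^ k) ℓ aj a m2 (fun i => Mh * P i) Λ x z)) ≤ C)
        ∧ (∀ (μ : Fin (d + 1)) (x : ↥(Box d ℓ k (fun i => (ℓ + 1) * (Mh * P i)))),
          roww δ ((ℓ + 1) ^ k) (dstar ((ℓ + 1) ^ k) μ (gTwoLevel ((ℓ + 1) ^ k) ℓ aj a m2 (fun i => Mh * P i) Λ)) x
            ≤ C)
        ∧ (∀ (μ : Fin (d + 1)) (x xe x' xe' : ↥(Box d ℓ k (fun i => (ℓ + 1) * (Mh * P i)))),
          xe.1 = x.1 + Pi.single μ 1 → xe'.1 = x'.1 + Pi.single μ 1 → x'.1 ≠ x.1 →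
          wsum2 δ ((ℓ + 1) ^ k) x x' (fun z => ((((ℓ + 1) ^ k : ℕ) : ℝ) / supNorm (x'.1 - x.1)) ^ α
              * ((((ℓ + 1) ^ k : ℕ) : ℝ)
                * ((gTwoLevel ((ℓ + 1) ^ k) ℓ aj a m2 (fun i => Mh * P i) Λ xe' z
                    - gTwoLevel ((ℓ + 1) ^ k) ℓ aj a m2 (fun i => Mh * P i) Λ x' z)
                  - (gTwoLevel ((ℓ + 1) ^ k) ℓ aj a m2 (fun i => Mh * P i) Λ xe z
                    - gTwoLevel ((ℓ + 1) ^ k) ℓ aj a m2 (fun i => Mh * P i) Λ x z)))) ≤ C)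
        ∧ (∀ (μ : Fin (d + 1)) (x x' : ↥(Box d ℓ k (fun i => (ℓ + 1) * (Mh * P i)))), x'.1 ≠ x.1 →
          wsum2 δ ((ℓ + 1) ^ k) x x' (fun z => ((((ℓ + 1) ^ k : ℕ) : ℝ) / supNorm (x'.1 - x.1)) ^ α
              * (dstar ((ℓ + 1) ^ k) μ (gTwoLevel ((ℓ + 1) ^ k) ℓ aj a m2 (fun i => Mh * P i) Λ) x' z
                - dstar ((ℓ + 1) ^ k) μ (gTwoLevel ((ℓ + 1) ^ k) ℓ aj a m2 (fun i => Mh * P i) Λ) x z)) ≤ C)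
        ∧ (∀ x : ↥(Box d ℓ k (fun i => (ℓ + 1) * (Mh * P i))),
          roww δ ((ℓ + 1) ^ k) (lapOp ((ℓ + 1) ^ k) _ * gTwoLevel ((ℓ + 1) ^ k) ℓ aj a m2 (fun i => Mh * P i) Λ) x
            ≤ C) := by
  obtain ⟨δP, MP, CP, hδP, hMP, hCP, hAll⟩ :=
    prop22_twoLevelBox d ℓ hℓ aminus aplus m2plus a2minus a2plus ha ha2 α hα0 hα1
  obtain ⟨δ₅, M₅, C₅, hδ₅, hM₅, hC₅, h5⟩ :=
    prop22_entry5_twoLevelBox d ℓ hℓ aminus aplus m2plus a2minus a2plus ha ha2 α hα0 hα1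
  refine ⟨min δP δ₅, MP + M₅, CP + C₅, lt_min hδP hδ₅, by positivity, by positivity, ?_⟩
  intro k hk aj m2 a e1 e2 e3 e4 e5 e6 Mh hMh hM P hP Λ hΛ
  have hdP : min δP δ₅ ≤ δP := min_le_left _ _
  have hd5 : min δP δ₅ ≤ δ₅ := min_le_right _ _
  have hmP : MP ≤ ((ℓ : ℝ) + 1) * Mh := by linarith
  have hm5 : M₅ ≤ ((ℓ : ℝ) + 1) * Mh := by linarith
  obtain ⟨h1, h2, h3, h4, h6⟩ := hAll k hk aj m2 a e1 e2 e3 e4 e5 e6 Mh hMh hmP P hP Λ hΛ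
  refine ⟨fun x => ?_, fun μ x xe hxe => ?_, fun μ x => ?_, fun μ x xe x' xe' hxe hxe' hne => ?_,
    fun μ x x' hne => ?_, fun x => ?_⟩
  · have := (roww_mono hdP _ _ _).trans (h1 x); linarith
  · have := (wsum_mono hdP _ _ _).trans (h2 μ x xe hxe); linarith
  · have := (roww_mono hdP _ _ _).trans (h3 μ x); linarith
  · have := (wsum2_mono_rate hdP _ _ _ _).trans (h4 μ x xe x' xe' hxe hxe' hne); linarith
  · have := (wsum2_mono_rate hd5 _ _ _ _).trans (h5 k hk aj m2 a e1 e2 e3 e4 e5 e6 Mh hMh hm5 P hP Λ hΛ μ x x' hne)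
    linarith
  · have := (roww_mono hdP _ _ _).trans (h6 x); linarith

/-! ## §5 Non-vacuity -/

/-- the quantifier prefix of the package is inhabited: `d + 1 = 4`, `L = 2`, unit windows, `α = 1/2`.
[cite: Balaban1984PropagatorsII, Proposition 2.2 (2.67) p.234] -/
example : ∃ δ M₀ C : ℝ, 0 < δ ∧ 0 < M₀ ∧ 0 < C :=
  let ⟨δ, M₀, C, hδ, hM₀, hC, _⟩ :=
    prop22_twoLevelBox 3 1 le_rfl 1 1 1 1 1 one_pos one_pos (1 / 2) (by norm_num) (by norm_num)
  ⟨δ, M₀, C, hδ, hM₀, hC⟩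

end

end Literature.MathematicalPhysics.QuantumFieldTheory.Balaban1983to89.B6Prop22AllTwoLevelBox
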